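import Summits.CriticalPhenomena.PercolationContinuityZ3.Theorems.PercNearOneGluingNoHeavyLowerTailQ7PsiOfCov
import Summits.CriticalPhenomena.PercolationContinuityZ3.Theorems.PercNearOneGluingNearOneGluingKnLemma3i
import HarnessLib

/-!
# `NoHeavyLowerTail` (stmt-CriticalPhenomena-4575) — lemmas for the MAX-ROBUST (GΨ₃) inequality (`λ* + μ* ≤ 1`)

Support file (lemma factory `prim-lf-3` gen 15; `--supports stmt-CriticalPhenomena-4575`).  No definitions, no named facts, no sorries.
Memo LF3-BETA-R.md §18h/§18m.  Ingredients of `λ* + μ* ≤ 1` for the coupling seat's closed-form certificate (assembled in `…Q7ThreeMaxRobust`):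
`Q7Psi.lam_mu_events` (inclusion–exclusion), `Q7Psi.ab_le_PQ` (BHK 1.3/1.4), `Q7Psi.lam_add_mu_le_one_arith`. [cite: KozmaNitzan2024, §5.1 (pp. 31–32), Question 7 (p. 36)] [cite: VandenbergHaggstromKahn2005, Thms 1.3–1.4 (pp. 6–7)]
-/

namespace Summit.CriticalPhenomena.PercolationContinuityZ3.Theorems

open MeasureTheory Set Literature.Probability.LatticeModels Literature.Probability.Percolation
open scoped Classical
open KNPreFKG BHK2006

noncomputable section

namespace Q7Psi

universe u

variable {V : Type u} [Fintype V]

/-- **Event bookkeeping for `λ* + μ* ≤ 1`** (memo §18h (S1)–(S6)): with `X = {x↔o} ∩ {x↮y}`, `Y = {y↔o} ∩ {y↮x}`, `W₃ = {x↔o} ∩ {x↔y} ∩ {x↮z}`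
(= `{y↔o} ∩ {y↔x} ∩ {y↮z}`), `E1 = {x↮y} ∩ {x↮z}`, `E2 = {y↮x} ∩ {y↮z}`: the six inclusion–exclusion inequalities
`μ(X,x↮z) + μ(W₃) + μ(Y,x↮z) ≤ μ(x↮z)`, `μ(Y,y↮z) + μ(W₃) + μ(X,y↮z) ≤ μ(y↮z)`, `μ(E1) + μ(W₃) ≤ μ(x↮z)`, `μ(E2) + μ(W₃) ≤ μ(y↮z)`,
`μ(X,x↮z) + μ(Y,x↮z) ≤ μ(E1)`, `μ(Y,y↮z) + μ(X,y↮z) ≤ μ(E2)`. [folklore] -/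
theorem lam_mu_events (w : Sym2 V → unitInterval) (o x y z : V) :
    ((prodBernoulli w).real (openConn x o ∩ {ω | ¬ (openGraph ω).Reachable x y} ∩ {ω | ¬ (openGraph ω).Reachable x z}) +
        (prodBernoulli w).real (openConn x o ∩ openConn x y ∩ {ω | ¬ (openGraph ω).Reachable x z}) +
        (prodBernoulli w).real (openConn y o ∩ {ω | ¬ (openGraph ω).Reachable y x} ∩ {ω | ¬ (openGraph ω).Reachable x z}) ≤
      (prodBernoulli w).real {ω : BondConfig V | ¬ (openGraph ω).Reachable x z}) ∧
    ((prodBernoulli w).real (openConn y o ∩ {ω | ¬ (openGraph ω).Reachable y x} ∩ {ω | ¬ (openGraph ω).Reachable y z}) +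
        (prodBernoulli w).real (openConn x o ∩ openConn x y ∩ {ω | ¬ (openGraph ω).Reachable x z}) +
        (prodBernoulli w).real (openConn x o ∩ {ω | ¬ (openGraph ω).Reachable x y} ∩ {ω | ¬ (openGraph ω).Reachable y z}) ≤
      (prodBernoulli w).real {ω : BondConfig V | ¬ (openGraph ω).Reachable y z}) ∧
    ((prodBernoulli w).real ({ω : BondConfig V | ¬ (openGraph ω).Reachable x y} ∩ {ω | ¬ (openGraph ω).Reachable x z}) +
        (prodBernoulli w).real (openConn x o ∩ openConn x y ∩ {ω | ¬ (openGraph ω).Reachable x z}) ≤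
      (prodBernoulli w).real {ω : BondConfig V | ¬ (openGraph ω).Reachable x z}) ∧
    ((prodBernoulli w).real ({ω : BondConfig V | ¬ (openGraph ω).Reachable y x} ∩ {ω | ¬ (openGraph ω).Reachable y z}) +
        (prodBernoulli w).real (openConn x o ∩ openConn x y ∩ {ω | ¬ (openGraph ω).Reachable x z}) ≤
      (prodBernoulli w).real {ω : BondConfig V | ¬ (openGraph ω).Reachable y z}) ∧
    ((prodBernoulli w).real (openConn x o ∩ {ω | ¬ (openGraph ω).Reachable x y} ∩ {ω | ¬ (openGraph ω).Reachable x z}) +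
        (prodBernoulli w).real (openConn y o ∩ {ω | ¬ (openGraph ω).Reachable y x} ∩ {ω | ¬ (openGraph ω).Reachable x z}) ≤
      (prodBernoulli w).real ({ω : BondConfig V | ¬ (openGraph ω).Reachable x y} ∩ {ω | ¬ (openGraph ω).Reachable x z})) ∧
    ((prodBernoulli w).real (openConn y o ∩ {ω | ¬ (openGraph ω).Reachable y x} ∩ {ω | ¬ (openGraph ω).Reachable y z}) +
        (prodBernoulli w).real (openConn x o ∩ {ω | ¬ (openGraph ω).Reachable x y} ∩ {ω | ¬ (openGraph ω).Reachable y z}) ≤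
      (prodBernoulli w).real ({ω : BondConfig V | ¬ (openGraph ω).Reachable y x} ∩ {ω | ¬ (openGraph ω).Reachable y z})) := by
  classical
  set μ := prodBernoulli w with hμ
  have hmeasV : ∀ S_ : Set (BondConfig V), MeasurableSet S_ := fun _ => MeasurableSet.of_discrete
  set XX : Set (BondConfig V) := openConn x o ∩ {ω | ¬ (openGraph ω).Reachable x y} with hXX
  set YY : Set (BondConfig V) := openConn y o ∩ {ω | ¬ (openGraph ω).Reachable y x} with hYY
  set Dxz : Set (BondConfig V) := {ω | ¬ (openGraph ω).Reachable x z} with hDxz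
  set Dyz : Set (BondConfig V) := {ω | ¬ (openGraph ω).Reachable y z} with hDyz
  set DD : Set (BondConfig V) := openConn x o ∩ openConn x y ∩ {ω | ¬ (openGraph ω).Reachable x z} with hDD
  set E1 : Set (BondConfig V) := {ω : BondConfig V | ¬ (openGraph ω).Reachable x y} ∩ {ω | ¬ (openGraph ω).Reachable x z} with hE1
  set E2 : Set (BondConfig V) := {ω : BondConfig V | ¬ (openGraph ω).Reachable y x} ∩ {ω | ¬ (openGraph ω).Reachable y z} with hE2
  have hXYdisj : Disjoint XX YY := by
    rw [Set.disjoint_left]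
    rintro ω ⟨hxo, hxy'⟩ ⟨hyo, _⟩
    exact hxy' ((hxo : (openGraph ω).Reachable x o).trans (hyo : (openGraph ω).Reachable y o).symm)
  -- DD as a `y`-event: {yo, yx, y≁z}
  have hDDy : ∀ ω ∈ DD, (openGraph ω).Reachable y x ∧ ¬ (openGraph ω).Reachable y z := by
    rintro ω ⟨⟨hxo, hxy'⟩, hxz'⟩
    exact ⟨hxy'.symm, fun h => hxz' (hxy'.trans h)⟩
  refine ⟨?_, ?_, ?_, ?_, ?_, ?_⟩
  · have h1 : Disjoint (XX ∩ Dxz) DD := by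
      rw [Set.disjoint_left]; rintro ω ⟨⟨_, hxy'⟩, _⟩ ⟨⟨_, hxy''⟩, _⟩; exact hxy' hxy''
    have h2 : Disjoint (XX ∩ Dxz ∪ DD) (YY ∩ Dxz) := by
      rw [Set.disjoint_left]
      rintro ω (⟨hX, _⟩ | ⟨⟨hxo, hxy'⟩, _⟩) ⟨hY, _⟩
      · exact (Set.disjoint_left.1 hXYdisj) hX hY
      · exact hY.2 ((hxy' : (openGraph ω).Reachable x y).symm)
    have hu : μ.real (XX ∩ Dxz ∪ DD) = μ.real (XX ∩ Dxz) + μ.real DD :=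
      measureReal_union h1 (hmeasV DD) (measure_ne_top _ _) (measure_ne_top _ _)
    have hu2 : μ.real ((XX ∩ Dxz ∪ DD) ∪ (YY ∩ Dxz)) = μ.real (XX ∩ Dxz ∪ DD) + μ.real (YY ∩ Dxz) :=
      measureReal_union h2 (hmeasV (YY ∩ Dxz)) (measure_ne_top _ _) (measure_ne_top _ _)
    have hsub : (XX ∩ Dxz ∪ DD) ∪ (YY ∩ Dxz) ⊆ Dxz :=
      union_subset (union_subset inter_subset_right (fun ω hω => hω.2)) inter_subset_right
    have hle := measureReal_mono hsub (measure_ne_top μ Dxz)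
    rw [hu2, hu] at hle
    exact hle
  · have h1 : Disjoint (YY ∩ Dyz) DD := by
      rw [Set.disjoint_left]; rintro ω ⟨⟨_, hyx'⟩, _⟩ hD; exact hyx' (hDDy ω hD).1
    have h2 : Disjoint (YY ∩ Dyz ∪ DD) (XX ∩ Dyz) := by
      rw [Set.disjoint_left]
      rintro ω (⟨hY, _⟩ | hD) ⟨hX, _⟩
      · exact (Set.disjoint_left.1 hXYdisj) hX hY
      · exact hX.2 (hDDy ω hD).1.symm
    have hu : μ.real (YY ∩ Dyz ∪ DD) = μ.real (YY ∩ Dyz) + μ.real DD :=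
      measureReal_union h1 (hmeasV DD) (measure_ne_top _ _) (measure_ne_top _ _)
    have hu2 : μ.real ((YY ∩ Dyz ∪ DD) ∪ (XX ∩ Dyz)) = μ.real (YY ∩ Dyz ∪ DD) + μ.real (XX ∩ Dyz) :=
      measureReal_union h2 (hmeasV (XX ∩ Dyz)) (measure_ne_top _ _) (measure_ne_top _ _)
    have hsub : (YY ∩ Dyz ∪ DD) ∪ (XX ∩ Dyz) ⊆ Dyz :=
      union_subset (union_subset inter_subset_right (fun ω hω => (hDDy ω hω).2)) inter_subset_right
    have hle := measureReal_mono hsub (measure_ne_top μ Dyz)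
    rw [hu2, hu] at hle
    exact hle
  · have h1 : Disjoint E1 DD := by
      rw [Set.disjoint_left]; rintro ω ⟨hxy', _⟩ ⟨⟨_, hxy''⟩, _⟩; exact hxy' hxy''
    have hu : μ.real (E1 ∪ DD) = μ.real E1 + μ.real DD :=
      measureReal_union h1 (hmeasV DD) (measure_ne_top _ _) (measure_ne_top _ _)
    have hsub : E1 ∪ DD ⊆ Dxz := union_subset inter_subset_right (fun ω hω => hω.2)
    have hle := measureReal_mono hsub (measure_ne_top μ Dxz)
    rw [hu] at hle; exact hle
  · have h1 : Disjoint E2 DD := by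
      rw [Set.disjoint_left]; rintro ω ⟨hyx', _⟩ hD; exact hyx' (hDDy ω hD).1
    have hu : μ.real (E2 ∪ DD) = μ.real E2 + μ.real DD :=
      measureReal_union h1 (hmeasV DD) (measure_ne_top _ _) (measure_ne_top _ _)
    have hsub : E2 ∪ DD ⊆ Dyz := union_subset inter_subset_right (fun ω hω => (hDDy ω hω).2)
    have hle := measureReal_mono hsub (measure_ne_top μ Dyz)
    rw [hu] at hle; exact hle
  · have h1 : Disjoint (XX ∩ Dxz) (YY ∩ Dxz) := by
      rw [Set.disjoint_left]; rintro ω ⟨hX, _⟩ ⟨hY, _⟩; exact (Set.disjoint_left.1 hXYdisj) hX hY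
    have hu : μ.real (XX ∩ Dxz ∪ YY ∩ Dxz) = μ.real (XX ∩ Dxz) + μ.real (YY ∩ Dxz) :=
      measureReal_union h1 (hmeasV (YY ∩ Dxz)) (measure_ne_top _ _) (measure_ne_top _ _)
    have hsub : XX ∩ Dxz ∪ YY ∩ Dxz ⊆ E1 := by
      rintro ω (⟨⟨_, hxy'⟩, hxz'⟩ | ⟨⟨_, hyx'⟩, hxz'⟩)
      · exact ⟨hxy', hxz'⟩
      · exact ⟨fun h => hyx' h.symm, hxz'⟩
    have hle := measureReal_mono hsub (measure_ne_top μ E1)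
    rw [hu] at hle; exact hle
  · have h1 : Disjoint (YY ∩ Dyz) (XX ∩ Dyz) := by
      rw [Set.disjoint_left]; rintro ω ⟨hY, _⟩ ⟨hX, _⟩; exact (Set.disjoint_left.1 hXYdisj) hX hY
    have hu : μ.real (YY ∩ Dyz ∪ XX ∩ Dyz) = μ.real (YY ∩ Dyz) + μ.real (XX ∩ Dyz) :=
      measureReal_union h1 (hmeasV (XX ∩ Dyz)) (measure_ne_top _ _) (measure_ne_top _ _)
    have hsub : YY ∩ Dyz ∪ XX ∩ Dyz ⊆ E2 := by
      rintro ω (⟨⟨_, hyx'⟩, hyz'⟩ | ⟨⟨_, hxy'⟩, hyz'⟩)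
      · exact ⟨hyx', hyz'⟩
      · exact ⟨fun h => hxy' h.symm, hyz'⟩
    have hle := measureReal_mono hsub (measure_ne_top μ E2)
    rw [hu] at hle; exact hle

/-- **BHK exchange of the isolation factors** (T1″ of memo §18h): with `X = {x↔o} ∩ {x↮y}`, `Y = {y↔o} ∩ {y↮x}`,
`μ(X, x↮z)·μ(Y, y↮z) ≤ μ(X, y↮z)·μ(Y, x↮z)`.  From BHK 2006 Thm 1.3 (`knLemma3i_oneCluster`: given `x↮y`, `{x↔o}` and `{x↔z}` are
positively correlated) and Thm 1.4 (`knLemma3i_twoCluster`: given `x↮y`, `{y↔o}` and `{x↔z}` are negatively correlated), twice.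
[cite: VandenbergHaggstromKahn2005, Thms 1.3–1.4 (pp. 6–7)] -/
theorem ab_le_PQ (w : Sym2 V → unitInterval) (o x y z : V) (hxy : x ≠ y) :
    (prodBernoulli w).real (openConn x o ∩ {ω | ¬ (openGraph ω).Reachable x y} ∩ {ω | ¬ (openGraph ω).Reachable x z}) *
        (prodBernoulli w).real (openConn y o ∩ {ω | ¬ (openGraph ω).Reachable y x} ∩ {ω | ¬ (openGraph ω).Reachable y z}) ≤
      (prodBernoulli w).real (openConn x o ∩ {ω | ¬ (openGraph ω).Reachable x y} ∩ {ω | ¬ (openGraph ω).Reachable y z}) *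
        (prodBernoulli w).real (openConn y o ∩ {ω | ¬ (openGraph ω).Reachable y x} ∩ {ω | ¬ (openGraph ω).Reachable x z}) := by
  classical
  set μ := prodBernoulli w with hμ
  have hyx : y ≠ x := fun h => hxy h.symm
  have hmeasV : ∀ S_ : Set (BondConfig V), MeasurableSet S_ := fun _ => MeasurableSet.of_discrete
  set XX : Set (BondConfig V) := openConn x o ∩ {ω | ¬ (openGraph ω).Reachable x y} with hXX
  set YY : Set (BondConfig V) := openConn y o ∩ {ω | ¬ (openGraph ω).Reachable y x} with hYY
  -- monotonicity of `{x ↔ z}` in `C_x`, of `{y ↔ z}` in `C_y`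
  have hQx : ∀ ω ω' : BondConfig V, ω ∈ (openConn x z : Set (BondConfig V)) →
      openEdgeCluster ω x ⊆ openEdgeCluster ω' x → ω' ∈ (openConn x z : Set (BondConfig V)) := by
    intro ω ω' hω hsub
    have h := (reachable_iff_exists_mem_openEdgeCluster ω x z).1 hω
    refine (reachable_iff_exists_mem_openEdgeCluster ω' x z).2 ?_
    rcases h with h | ⟨e, he, hze⟩
    · exact Or.inl h
    · exact Or.inr ⟨e, hsub he, hze⟩
  have hQy : ∀ ω ω' : BondConfig V, ω ∈ (openConn y z : Set (BondConfig V)) →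
      openEdgeCluster ω y ⊆ openEdgeCluster ω' y → ω' ∈ (openConn y z : Set (BondConfig V)) := by
    intro ω ω' hω hsub
    have h := (reachable_iff_exists_mem_openEdgeCluster ω y z).1 hω
    refine (reachable_iff_exists_mem_openEdgeCluster ω' y z).2 ?_
    rcases h with h | ⟨e, he, hze⟩
    · exact Or.inl h
    · exact Or.inr ⟨e, hsub he, hze⟩
  have B1 := knLemma3i_oneCluster w x y o (openConn x z) hQx hxy
  have B2 := knLemma3i_twoCluster w y x o (openConn x z) hQx hyx
  have B3 := knLemma3i_oneCluster w y x o (openConn y z) hQy hyx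
  have B4 := knLemma3i_twoCluster w x y o (openConn y z) hQy hxy
  have hDsym : ((openConn y x)ᶜ : Set (BondConfig V)) = (openConn x y)ᶜ := by rw [openConn_symm]
  rw [hDsym] at B2 B3
  have eX : ((openConn x y)ᶜ ∩ openConn x o : Set (BondConfig V)) = XX := by
    ext ω; simp only [hXX, mem_inter_iff, mem_compl_iff, mem_setOf_eq]; exact ⟨fun h => ⟨h.2, h.1⟩, fun h => ⟨h.2, h.1⟩⟩
  have eY : ((openConn x y)ᶜ ∩ openConn y o : Set (BondConfig V)) = YY := by
    ext ω; simp only [hYY, mem_inter_iff, mem_compl_iff, mem_setOf_eq]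
    exact ⟨fun h => ⟨h.2, fun h' => h.1 h'.symm⟩, fun h => ⟨fun h' => h.2 h'.symm, h.1⟩⟩
  have eXz : ((openConn x y)ᶜ ∩ (openConn x o ∩ openConn x z) : Set (BondConfig V)) = XX ∩ openConn x z := by
    rw [← inter_assoc, eX]
  have eYxz : ((openConn x y)ᶜ ∩ (openConn y o ∩ openConn x z) : Set (BondConfig V)) = YY ∩ openConn x z := by
    rw [← inter_assoc, eY]
  have eYz : ((openConn x y)ᶜ ∩ (openConn y o ∩ openConn y z) : Set (BondConfig V)) = YY ∩ openConn y z := by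
    rw [← inter_assoc, eY]
  have eXyz : ((openConn x y)ᶜ ∩ (openConn x o ∩ openConn y z) : Set (BondConfig V)) = XX ∩ openConn y z := by
    rw [← inter_assoc, eX]
  rw [eX, eXz] at B1
  rw [eYxz, eY] at B2
  rw [eY, eYz] at B3
  rw [eXyz, eX] at B4
  -- complements inside `X` and `Y`
  have cX := measureReal_inter_add_sdiff (μ := μ) (s := XX) (hmeasV (openConn x z)) (measure_ne_top _ _)
  have cY := measureReal_inter_add_sdiff (μ := μ) (s := YY) (hmeasV (openConn x z)) (measure_ne_top _ _)
  have cY' := measureReal_inter_add_sdiff (μ := μ) (s := YY) (hmeasV (openConn y z)) (measure_ne_top _ _)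
  have cX' := measureReal_inter_add_sdiff (μ := μ) (s := XX) (hmeasV (openConn y z)) (measure_ne_top _ _)
  have dX : (XX \ openConn x z : Set (BondConfig V)) = openConn x o ∩ {ω | ¬ (openGraph ω).Reachable x y} ∩
      {ω | ¬ (openGraph ω).Reachable x z} := rfl
  have dY : (YY \ openConn x z : Set (BondConfig V)) = openConn y o ∩ {ω | ¬ (openGraph ω).Reachable y x} ∩
      {ω | ¬ (openGraph ω).Reachable x z} := rfl
  have dY' : (YY \ openConn y z : Set (BondConfig V)) = openConn y o ∩ {ω | ¬ (openGraph ω).Reachable y x} ∩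
      {ω | ¬ (openGraph ω).Reachable y z} := rfl
  have dX' : (XX \ openConn y z : Set (BondConfig V)) = openConn x o ∩ {ω | ¬ (openGraph ω).Reachable x y} ∩
      {ω | ¬ (openGraph ω).Reachable y z} := rfl
  rw [dX] at cX; rw [dY] at cY; rw [dY'] at cY'; rw [dX'] at cX'
  have hXD : μ.real XX ≤ μ.real ((openConn x y)ᶜ : Set (BondConfig V)) :=
    measureReal_mono (fun ω hω => hω.2) (measure_ne_top _ _)
  have hYD : μ.real YY ≤ μ.real ((openConn x y)ᶜ : Set (BondConfig V)) :=
    measureReal_mono (fun ω hω => fun h => hω.2 h.symm) (measure_ne_top _ _)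
  set a := μ.real (openConn x o ∩ {ω | ¬ (openGraph ω).Reachable x y} ∩ {ω | ¬ (openGraph ω).Reachable x z}) with ha
  set b := μ.real (openConn y o ∩ {ω | ¬ (openGraph ω).Reachable y x} ∩ {ω | ¬ (openGraph ω).Reachable y z}) with hb
  set Pm := μ.real (openConn x o ∩ {ω | ¬ (openGraph ω).Reachable x y} ∩ {ω | ¬ (openGraph ω).Reachable y z}) with hPm
  set Qm := μ.real (openConn y o ∩ {ω | ¬ (openGraph ω).Reachable y x} ∩ {ω | ¬ (openGraph ω).Reachable x z}) with hQm
  set mX := μ.real XX with hmX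
  set mY := μ.real YY with hmY
  set mD := μ.real ((openConn x y)ᶜ : Set (BondConfig V)) with hmD
  set Xz := μ.real (XX ∩ openConn x z) with hXz
  set Yxz := μ.real (YY ∩ openConn x z) with hYxz
  set Yz := μ.real (YY ∩ openConn y z) with hYz
  set Xyz := μ.real (XX ∩ openConn y z) with hXyz
  set Dz := μ.real (((openConn x y)ᶜ : Set (BondConfig V)) ∩ openConn x z) with hDz
  set Dz' := μ.real (((openConn x y)ᶜ : Set (BondConfig V)) ∩ openConn y z) with hDz'
  have ha0 : 0 ≤ a := measureReal_nonneg
  have hb0 : 0 ≤ b := measureReal_nonneg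
  have hPm0 : 0 ≤ Pm := measureReal_nonneg
  have hQm0 : 0 ≤ Qm := measureReal_nonneg
  have hmX0 : 0 ≤ mX := measureReal_nonneg
  have hmY0 : 0 ≤ mY := measureReal_nonneg
  have hmD0 : 0 ≤ mD := measureReal_nonneg
  have hXz0 : 0 ≤ Xz := measureReal_nonneg
  have hYxz0 : 0 ≤ Yxz := measureReal_nonneg
  have hYz0 : 0 ≤ Yz := measureReal_nonneg
  have hXyz0 : 0 ≤ Xyz := measureReal_nonneg
  have hDz0 : 0 ≤ Dz := measureReal_nonneg
  have hDz'0 : 0 ≤ Dz' := measureReal_nonneg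
  have haeq : a = mX - Xz := by linarith only [cX]
  have hQeq : Qm = mY - Yxz := by linarith only [cY]
  have hbeq : b = mY - Yz := by linarith only [cY']
  have hPeq : Pm = mX - Xyz := by linarith only [cX']
  clear_value a b Pm Qm mX mY mD Xz Yxz Yz Xyz Dz Dz'
  -- T1″a: mX·Yxz ≤ mY·Xz ; T1″b: mY·Xyz ≤ mX·Yz
  have T1a : mX * Yxz ≤ mY * Xz := by
    by_cases hD0 : mD = 0
    · have : mX = 0 := le_antisymm (hD0 ▸ hXD) hmX0
      rw [this, zero_mul]; exact mul_nonneg hmY0 hXz0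
    · have hDpos : 0 < mD := lt_of_le_of_ne hmD0 (Ne.symm hD0)
      have h1 : mX * (mD * Yxz) ≤ mX * (mY * Dz) := mul_le_mul_of_nonneg_left (by linarith only [B2]) hmX0
      have h2 : mY * (mX * Dz) ≤ mY * (mD * Xz) := mul_le_mul_of_nonneg_left (by linarith only [B1]) hmY0
      have h3 : mD * (mX * Yxz) ≤ mD * (mY * Xz) := by
        have e1 : mD * (mX * Yxz) = mX * (mD * Yxz) := by ring
        have e2 : mD * (mY * Xz) = mY * (mD * Xz) := by ring
        have e3 : mX * (mY * Dz) = mY * (mX * Dz) := by ring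
        rw [e1, e2]; linarith only [h1, h2, e3]
      exact le_of_mul_le_mul_left h3 hDpos
  have T1b : mY * Xyz ≤ mX * Yz := by
    by_cases hD0 : mD = 0
    · have : mY = 0 := le_antisymm (hD0 ▸ hYD) hmY0
      rw [this, zero_mul]; exact mul_nonneg hmX0 hYz0
    · have hDpos : 0 < mD := lt_of_le_of_ne hmD0 (Ne.symm hD0)
      have h1 : mY * (mD * Xyz) ≤ mY * (mX * Dz') := mul_le_mul_of_nonneg_left (by linarith only [B4]) hmY0
      have h2 : mX * (mY * Dz') ≤ mX * (mD * Yz) := mul_le_mul_of_nonneg_left (by linarith only [B3]) hmX0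
      have h3 : mD * (mY * Xyz) ≤ mD * (mX * Yz) := by
        have e1 : mD * (mY * Xyz) = mY * (mD * Xyz) := by ring
        have e2 : mD * (mX * Yz) = mX * (mD * Yz) := by ring
        have e3 : mY * (mX * Dz') = mX * (mY * Dz') := by ring
        rw [e1, e2]; linarith only [h1, h2, e3]
      exact le_of_mul_le_mul_left h3 hDpos
  have hA1 : a * mY ≤ Qm * mX := by
    have e1 : a * mY = mX * mY - mY * Xz := by rw [haeq]; ring
    have e2 : Qm * mX = mX * mY - mX * Yxz := by rw [hQeq]; ring
    rw [e1, e2]; linarith only [T1a]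
  have hA2 : b * mX ≤ Pm * mY := by
    have e1 : b * mX = mX * mY - mX * Yz := by rw [hbeq]; ring
    have e2 : Pm * mY = mX * mY - mY * Xyz := by rw [hPeq]; ring
    rw [e1, e2]; linarith only [T1b]
  have haX' : a ≤ mX := by rw [haeq]; linarith only [hXz0]
  have hbY' : b ≤ mY := by rw [hbeq]; linarith only [hYz0]
  by_cases hX0 : mX = 0
  · have : a = 0 := le_antisymm (hX0 ▸ haX') ha0
    rw [this, zero_mul]; exact mul_nonneg hPm0 hQm0
  by_cases hY0 : mY = 0
  · have : b = 0 := le_antisymm (hY0 ▸ hbY') hb0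
    rw [this, mul_zero]; exact mul_nonneg hPm0 hQm0
  have hXpos : 0 < mX := lt_of_le_of_ne hmX0 (Ne.symm hX0)
  have hYpos : 0 < mY := lt_of_le_of_ne hmY0 (Ne.symm hY0)
  have h12 : (a * mY) * (b * mX) ≤ (Qm * mX) * (Pm * mY) :=
    mul_le_mul hA1 hA2 (by positivity) (by positivity)
  have key : (mX * mY) * (a * b) ≤ (mX * mY) * (Pm * Qm) :=
    calc (mX * mY) * (a * b) = (a * mY) * (b * mX) := by ring
      _ ≤ (Qm * mX) * (Pm * mY) := h12
      _ = (mX * mY) * (Pm * Qm) := by ring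
  exact le_of_mul_le_mul_left key (by positivity)

/-- **The arithmetic of `λ* + μ* ≤ 1`** (memo §18h): from the seven event inequalities (S1)–(S7) the closed-form multipliers satisfy
`(a + t d)/Ax + (b + (1−t) d)/Ay ≤ 1`, `t = a e2/(a e2 + b e1)` (`t = 0` if the denominator vanishes). [folklore] -/
theorem lam_add_mu_le_one_arith (a b d e1 e2 Ax Ay Pm Qm t s : ℝ)
    (ha0 : 0 ≤ a) (hb0 : 0 ≤ b) (hd0 : 0 ≤ d) (hPm0 : 0 ≤ Pm) (hQm0 : 0 ≤ Qm) (he1pos : 0 < e1) (he2pos : 0 < e2)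
    (hAxpos : 0 < Ax) (hAypos : 0 < Ay)
    (hS1 : a + d + Qm ≤ Ax) (hS2 : b + d + Pm ≤ Ay) (hS3 : e1 + d ≤ Ax) (hS4 : e2 + d ≤ Ay) (hS5 : a + Qm ≤ e1) (hS6 : b + Pm ≤ e2)
    (hS7 : a * b ≤ Pm * Qm) (hs : s = a * e2 + b * e1) (ht : t = if 0 < s then a * e2 / s else 0) :
    (a + t * d) / Ax + (b + (1 - t) * d) / Ay ≤ 1 := by
  set P' : ℝ := Ay - b - d with hP'
  set Q' : ℝ := Ax - a - d with hQ'
  have hP'P : Pm ≤ P' := by rw [hP']; linarith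
  have hQ'Q : Qm ≤ Q' := by rw [hQ']; linarith
  have hPQ' : a * b ≤ P' * Q' := hS7.trans (mul_le_mul hP'P hQ'Q hQm0 (hPm0.trans hP'P))
  have hPhi1 : d * (Q' - b) ≤ (Ay - b) * (Ax - a - d) - a * b - b * d := by
    have : (Ay - b) * (Ax - a - d) - a * b - b * d - d * (Q' - b) = P' * Q' - a * b := by rw [hP', hQ']; ring
    linarith [hPQ']
  have hPhi0 : d * (P' - a) ≤ (Ax - a) * (Ay - b - d) - a * b - a * d := by
    have : (Ax - a) * (Ay - b - d) - a * b - a * d - d * (P' - a) = P' * Q' - a * b := by rw [hP', hQ']; ring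
    linarith [hPQ']
  -- key: a e2 Q' + b e1 P' ≥ ab (e1 + e2)
  have hK1 : a * b * (e1 + e2) ≤ a * e2 * Q' + b * e1 * P' := by
    have he2b : b ≤ e2 := by linarith
    have he1a : a ≤ e1 := by linarith
    have k6 : e1 ≤ a + Q' := by rw [hQ']; linarith
    have k7 : e2 ≤ b + P' := by rw [hP']; linarith
    -- a e2 Q' ≥ a (b + Pm) Qm + a b (Q' - Qm) ... assembled by nlinarith
    have u1 : a * (b + Pm) * Qm ≤ a * e2 * Qm := mul_le_mul_of_nonneg_right (mul_le_mul_of_nonneg_left hS6 ha0) hQm0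
    have u2 : b * (a + Qm) * Pm ≤ b * e1 * Pm := mul_le_mul_of_nonneg_right (mul_le_mul_of_nonneg_left hS5 hb0) hPm0
    have u3 : a * b * (Q' - Qm) ≤ a * e2 * (Q' - Qm) :=
      mul_le_mul_of_nonneg_right (mul_le_mul_of_nonneg_left he2b ha0) (sub_nonneg.2 hQ'Q)
    have u4 : b * a * (P' - Pm) ≤ b * e1 * (P' - Pm) :=
      mul_le_mul_of_nonneg_right (mul_le_mul_of_nonneg_left he1a hb0) (sub_nonneg.2 hP'P)
    have u5 : (a + b) * (a * b) ≤ (a + b) * (Pm * Qm) := mul_le_mul_of_nonneg_left hS7 (add_nonneg ha0 hb0)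
    have u6 : a * b * (e1 + e2) ≤ a * b * ((a + Q') + (b + P')) :=
      mul_le_mul_of_nonneg_left (add_le_add k6 k7) (mul_nonneg ha0 hb0)
    have expand : a * e2 * Q' + b * e1 * P' - a * b * (e1 + e2) =
        (a * e2 * Qm - a * (b + Pm) * Qm) + (b * e1 * Pm - b * (a + Qm) * Pm) +
        (a * e2 * (Q' - Qm) - a * b * (Q' - Qm)) + (b * e1 * (P' - Pm) - b * a * (P' - Pm)) +
        ((a + b) * (Pm * Qm) - (a + b) * (a * b)) + (a * b * ((a + Q') + (b + P')) - a * b * (e1 + e2)) := by ring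
    have : 0 ≤ a * e2 * Q' + b * e1 * P' - a * b * (e1 + e2) := by
      rw [expand]
      have v1 := sub_nonneg.2 u1; have v2 := sub_nonneg.2 u2; have v3 := sub_nonneg.2 u3
      have v4 := sub_nonneg.2 u4; have v5 := sub_nonneg.2 u5; have v6 := sub_nonneg.2 u6
      positivity
    linarith only [this]
  -- t Φ(1) + (1 - t) Φ(0) ≥ 0
  have hs0 : 0 ≤ s := by rw [hs]; positivity
  have hcomb : 0 ≤ t * ((Ay - b) * (Ax - a - d) - a * b - b * d) +
      (1 - t) * ((Ax - a) * (Ay - b - d) - a * b - a * d) := by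
    by_cases hsp : 0 < s
    · have htv : t = a * e2 / s := by rw [ht, if_pos hsp]
      have e_t : t * s = a * e2 := by rw [htv]; field_simp
      have e_t' : (1 - t) * s = b * e1 := by rw [hs] at e_t ⊢; linarith
      have hge : 0 ≤ a * e2 * ((Ay - b) * (Ax - a - d) - a * b - b * d) +
          b * e1 * ((Ax - a) * (Ay - b - d) - a * b - a * d) := by
        have u1 : a * e2 * (d * (Q' - b)) ≤ a * e2 * ((Ay - b) * (Ax - a - d) - a * b - b * d) :=
          mul_le_mul_of_nonneg_left hPhi1 (by positivity)
        have u2 : b * e1 * (d * (P' - a)) ≤ b * e1 * ((Ax - a) * (Ay - b - d) - a * b - a * d) :=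
          mul_le_mul_of_nonneg_left hPhi0 (by positivity)
        have u3 : 0 ≤ d * (a * e2 * Q' + b * e1 * P' - a * b * (e1 + e2)) := mul_nonneg hd0 (by linarith only [hK1])
        have expand : a * e2 * ((Ay - b) * (Ax - a - d) - a * b - b * d) + b * e1 * ((Ax - a) * (Ay - b - d) - a * b - a * d) =
            (a * e2 * ((Ay - b) * (Ax - a - d) - a * b - b * d) - a * e2 * (d * (Q' - b))) +
            (b * e1 * ((Ax - a) * (Ay - b - d) - a * b - a * d) - b * e1 * (d * (P' - a))) +
            d * (a * e2 * Q' + b * e1 * P' - a * b * (e1 + e2)) := by ring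
        rw [expand]
        have v1 := sub_nonneg.2 u1; have v2 := sub_nonneg.2 u2
        positivity
      have hid : s * (t * ((Ay - b) * (Ax - a - d) - a * b - b * d) +
          (1 - t) * ((Ax - a) * (Ay - b - d) - a * b - a * d)) =
          a * e2 * ((Ay - b) * (Ax - a - d) - a * b - b * d) +
          b * e1 * ((Ax - a) * (Ay - b - d) - a * b - a * d) := by
        rw [← e_t, ← e_t']; ring
      by_contra hneg
      push Not at hneg
      have : s * (t * ((Ay - b) * (Ax - a - d) - a * b - b * d) +
          (1 - t) * ((Ax - a) * (Ay - b - d) - a * b - a * d)) < 0 := mul_neg_of_pos_of_neg hsp hneg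
      linarith
    · have hs0' : s = 0 := le_antisymm (not_lt.1 hsp) hs0
      have ht0 : t = 0 := by rw [ht, if_neg hsp]
      have ha' : a = 0 := by
        have h2 : a * e2 = 0 := le_antisymm (by nlinarith [mul_nonneg hb0 he1pos.le]) (by positivity)
        rcases mul_eq_zero.1 h2 with h | h
        · exact h
        · exact absurd h (ne_of_gt he2pos)
      have hb' : b = 0 := by
        have h2 : b * e1 = 0 := le_antisymm (by nlinarith [mul_nonneg ha0 he2pos.le]) (by positivity)
        rcases mul_eq_zero.1 h2 with h | h
        · exact h
        · exact absurd h (ne_of_gt he1pos)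
      rw [ht0, ha', hb']
      have hdA : d ≤ Ay := by linarith only [hS2, hb0, hPm0]
      have hprod := mul_nonneg hAxpos.le (sub_nonneg.2 hdA)
      nlinarith only [hprod]
  have key : (a + t * d) * Ay + (b + (1 - t) * d) * Ax ≤ Ax * Ay := by
    have : Ax * Ay - ((a + t * d) * Ay + (b + (1 - t) * d) * Ax) =
        t * ((Ay - b) * (Ax - a - d) - a * b - b * d) + (1 - t) * ((Ax - a) * (Ay - b - d) - a * b - a * d) := by ring
    linarith [hcomb]
  rw [div_add_div _ _ (ne_of_gt hAxpos) (ne_of_gt hAypos), div_le_one (by positivity)]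
  linarith [key]

end Q7Psi

end

end Summit.CriticalPhenomena.PercolationContinuityZ3.Theorems
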